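import Mathlib
import HarnessLib
import Summits.HubbardSuperconductivity.HubbardSuperconductivity.Theorems.KLProgrammeFermiSurfaceExtWindow
import Summits.HubbardSuperconductivity.HubbardSuperconductivity.Theorems.KLProgrammeFermiSurfaceExtWindowSharp
import Summits.HubbardSuperconductivity.HubbardSuperconductivity.Theorems.WeakCouplingBCSWcbcsKohnLuttingerB1gMuWindow
import Summits.HubbardSuperconductivity.HubbardSuperconductivity.Theorems.WeakCouplingBCSKlCertFillingLowerD005
import Summits.HubbardSuperconductivity.HubbardSuperconductivity.Theorems.WeakCouplingBCSKlCertFillingUpperD025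

/-!
# Route `KLProgramme` / `WeakCouplingBCS` — risk-register item r2 «Fermi-surface hypotheses» AS `δ`-THEOREMS on the
# EXTENDED doping window `δ ∈ [0.05, 0.25]` (cert-2's window; `μ(δ) ∈ [-0.5725, -0.075]`)

Cell `gate-hubbard-kl`, seat fs-1 (g7). `KLProgrammeFermiSurfaceExtWindow.lean` / `…ExtWindowSharp.lean` (fs-1 g6) state every
Fermi-surface row of the lineage on the extended chemical-potential window `μ ∈ [-0.5725, -0.075]` (decl prefix `klfs_xwin_`).
The route's statements speak of the hole DOPING `δ` through `μ(δ) = chemicalPotentialOfDensity ε₀ (1 - δ)`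
(`ε₀ = squareDispersion 1 0`). The link `δ ∈ [0.05, 0.25] ⇒ μ(δ) ∈ [-0.5725, -0.075]` follows from the two certified window-end
fillings already in the tree — `n(-0.075) ≥ 19/20` (`klfillL005_filling_ge`, seat cert-3, p458461) and `n(-0.5725) ≤ 3/4`
(`klfillU025_filling_le`, cert-3, p458472) — by monotonicity of the filling (`chemicalPotentialOfDensity_window`); it is
derived here as a PRIVATE lemma only (the public packaging of that link belongs to cert-3's form-(A) certificate file for
`δ ∈ [0.05, 0.25]`, `muOfDoping_mem_window_d005_d025`, filed with cert-2's WinD record; on `δ ∈ [0.10, 0.25]` cert-3's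
`muOfDoping_mem_window_d010_d025` is already landed). This file is the `[0.05, 0.25]` edition of
`KLProgrammeFermiSurfaceDopingForm.lean` §1:

* for every `δ ∈ [0.05, 0.25]`, at `μ = μ(δ)`: `-2 < μ(δ) < 0`; `v_F = ‖∇ε₀‖ ≥ 0.5425`, `∇ε₀ ≠ 0`, `0.0132 ≤ κ ≤ 3.69`, nesting
  defect `≥ 0.15` (`klfs_xdoping_geometry`); FST II (A1)–(A4), (Sy), (A3) global HOLD and (A5) FAILS, with the `(1,0)` umklapp
  quadruple, a pair `p + q ∉` Brillouin zone and the `(1,0)`-corner (`klfs_xdoping_fst2_umklapp`) — «A5 fails ⇒ C4b is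
  load-bearing» on the whole extended doping window; corner transversality factor `≥ 0.0428`; `GeomConstants e 4.5725 0.0375
  0.381 0.0187` and FST III `Admits M ⟨0, 42, normV, 0.38, 0.0375, 0.0187⟩` + (H1)–(H4), `¬(H5)` (`klfs_xdoping_fst_constants`);
  FST IV / BGM 2006 / FKT 2004 EXCLUDE the band, Salmhofer 1998 admits it (`klfs_xdoping_classes`); BGM 2003
  `DispersionHyp`/`LatticeModelHyp`/Lemma 3.1 with `e₀ = 0.05` (`klfs_xdoping_bgm2003`); `∂ₜF ≥ 0.5424`
  (`klfs_xdoping_rayDispersionDt_ge`); ONE two-loop constant `Q` (FST II Thm 1.1) for the whole extended doping window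
  (`klfs_xdoping_volW_le`); the SHARP `BandBounds (-0.5725) (-0.075)` bundle (`C_g ≤ 556`, …) covers every `μ(δ)`
  (`klfs_xdoping_sharpBandBounds`).
* the doping window of record `[0.10, 0.20]` and the certificate's current form-(A) window `[0.10, 0.25]` are sub-windows
  (`klfs_xdoping_of_sub`), so every row above holds on them verbatim (their SHARPER constants: `…DopingForm.lean` §1 and
  `KLProgrammeFermiSurfaceCertWindowD010D025.lean`).

The binding end is `δ = 0.05` (`μ = -0.075`, `2.4×` closer to the van Hove level than `μ(0.10)`): the curvature floor halves and
`C_g` grows `5.7×` relative to `[0.10, 0.20]` (FS-WINDOW.md §9; certified values kit j257184). No definitions; everything PROVED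
(compositions). [folklore]
-/

noncomputable section

open Real Set

-- the tree's namespace `Summit.<Summit>.<Problem>.Theorems` repeats the summit name by design (D-0017)
set_option linter.dupNamespace false

namespace Summit.HubbardSuperconductivity.HubbardSuperconductivity.Theorems

open Literature.MathematicalPhysics.QuantumLattice
open Literature.MathematicalPhysics.QuantumLattice.BandSectorCounting

/-! ### §0 The link `δ ↦ μ(δ)` on `[0.05, 0.25]` (private; public form = cert-3's certificate file) and the sub-windows -/

/-- `μ(δ) ∈ [-0.5725, -0.075]` for `δ ∈ [0.05, 0.25]`: the certified fillings `n(-0.075) ≥ 19/20` (`klfillL005_filling_ge`) and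
`n(-0.5725) ≤ 3/4` (`klfillU025_filling_le`) put `[0.05, 0.25]` inside `[1 - n(-0.075), 1 - n(-0.5725)]`, on which `δ ↦ μ(δ)`
inverts the strictly increasing filling (`chemicalPotentialOfDensity_window`). Private: the public decl of this link is cert-3's
(`muOfDoping_mem_window_d005_d025`, with the `δ ∈ [0.05, 0.25]` certificate). [folklore] -/
private theorem klfs_xdoping_link_aux :
    ∀ δ ∈ Icc (0.05 : ℝ) 0.25,
      chemicalPotentialOfDensity (squareDispersion 1 0) (1 - δ) ∈ Icc (-0.5725 : ℝ) (-0.075) := by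
  obtain ⟨-, -, -, H⟩ := chemicalPotentialOfDensity_window (μ₁ := (-0.075 : ℝ)) (μ₂ := (-0.5725 : ℝ))
    (by norm_num) (by norm_num) (by norm_num)
  have hlo := klfillL005_filling_ge
  have hhi := klfillU025_filling_le
  rw [show (-(3 / 40) : ℝ) = -0.075 by norm_num] at hlo
  rw [show (-(229 / 400) : ℝ) = -0.5725 by norm_num] at hhi
  intro δ hδ
  refine H δ ⟨?_, ?_⟩
  · norm_num at hδ hlo ⊢; linarith [hδ.1]
  · norm_num at hδ hhi ⊢; linarith [hδ.2]

/-- **`μ(δ)` lies in the extended window `[-0.5725, -0.075]` for every `δ ∈ [0.05, 0.25]`, hence `-2 < μ(δ) < 0`** (from the two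
certified window-end fillings; cf. cert-3's certificate files for the public link). [folklore] -/
theorem klfs_muOfDoping_mem_xwin {δ : ℝ} (hδ : δ ∈ Icc (0.05 : ℝ) 0.25) :
    chemicalPotentialOfDensity (squareDispersion 1 0) (1 - δ) ∈ Icc (-0.5725 : ℝ) (-0.075) ∧
    -2 < chemicalPotentialOfDensity (squareDispersion 1 0) (1 - δ) ∧
    chemicalPotentialOfDensity (squareDispersion 1 0) (1 - δ) < 0 := by
  have h := klfs_xdoping_link_aux δ hδ
  exact ⟨h, klfs_xwin_sub h⟩

/-- The doping window of record `[0.10, 0.20]` and the certificate's form-(A) window `[0.10, 0.25]` are sub-windows of the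
extended doping window `[0.05, 0.25]`. [folklore] -/
theorem klfs_xdoping_of_sub {δ : ℝ} (hδ : δ ∈ Icc (0.10 : ℝ) 0.20 ∨ δ ∈ Icc (0.10 : ℝ) 0.25) : δ ∈ Icc (0.05 : ℝ) 0.25 := by
  rcases hδ with h | h
  · exact ⟨by linarith [h.1], by linarith [h.2]⟩
  · exact ⟨by linarith [h.1], h.2⟩

/-! ### §1 The rows at `μ(δ)`, `δ ∈ [0.05, 0.25]` -/

/-- **Speed, curvature, nesting at `μ(δ)`, `δ ∈ [0.05, 0.25]`**: on the Fermi curve `{ε₀ = μ(δ)}`, `∇ε₀ ≠ 0` and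
`‖∇ε₀‖ ≥ 0.5425`; at every level point `-2(cos x + cos y) = μ(δ)` the curvature lies in `[0.0132, 3.69]`; the `(π,π)` nesting
defect is `≥ 0.15`. [folklore] -/
theorem klfs_xdoping_geometry {δ : ℝ} (hδ : δ ∈ Icc (0.05 : ℝ) 0.25) :
    (∀ k ∈ fermiCurve (squareDispersion 1 0) (chemicalPotentialOfDensity (squareDispersion 1 0) (1 - δ)),
      gradient (squareDispersion 1 0) k ≠ 0 ∧ (0.5425 : ℝ) ≤ ‖gradient (squareDispersion 1 0) k‖) ∧
    (∀ x y : ℝ, -2 * (Real.cos x + Real.cos y) = chemicalPotentialOfDensity (squareDispersion 1 0) (1 - δ) →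
      (Real.cos x * Real.sin y ^ 2 + Real.cos y * Real.sin x ^ 2) /
        ((Real.sin x ^ 2 + Real.sin y ^ 2) * Real.sqrt (Real.sin x ^ 2 + Real.sin y ^ 2)) ∈ Icc (0.0132 : ℝ) 3.69) ∧
    (∀ k : Fin 2 → ℝ, sqDispersion k = chemicalPotentialOfDensity (squareDispersion 1 0) (1 - δ) →
      (0.15 : ℝ) ≤ |sqDispersion (fun i => k i + π) - chemicalPotentialOfDensity (squareDispersion 1 0) (1 - δ)|) := by
  have hμ := (klfs_muOfDoping_mem_xwin hδ).1
  exact ⟨fun k hk => ⟨klfs_xwin_gradient_ne_zero hμ hk, klfs_xwin_norm_gradient_ge hμ hk⟩,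
    fun x y h => klfs_xwin_curvature hμ h, fun k hk => klfs_xwin_nesting_defect hμ hk⟩

/-- **FST II's hypotheses at `μ(δ)`, `δ ∈ [0.05, 0.25]`: (A1)–(A4), (Sy), (A3) global HOLD, (A5) FAILS** — with the explicit
`(1,0)` umklapp quadruple on the Fermi curve, a pair `p + q ∉` Brillouin zone, and the `(1,0)`-corner `3 p(θ*) ∈ F + 2π(1,0)`,
`0 < θ* < π/4` («the window HAS umklapp ⇒ A5 fails ⇒ C4b is load-bearing», on the extended doping window). [folklore] -/
theorem klfs_xdoping_fst2_umklapp {δ : ℝ} (hδ : δ ∈ Icc (0.05 : ℝ) 0.25) (U : ℝ) (k : ℕ) :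
    (FermiRG.HypA1 (FermiRG.Crystal.cubic 2) k 0 (fun _ : ℝ × Momentum => (U : ℂ)) ∧
      FermiRG.HypA2 (FermiRG.Crystal.cubic 2) k 0
        (fun q : Momentum => squareDispersion 1 0 q - chemicalPotentialOfDensity (squareDispersion 1 0) (1 - δ)) ∧
      FermiRG.HypA3 (fun q : Momentum => squareDispersion 1 0 q - chemicalPotentialOfDensity (squareDispersion 1 0) (1 - δ)) ∧
      FermiRG.HypA3Global (FermiRG.Crystal.cubic 2)
        (fun q : Momentum => squareDispersion 1 0 q - chemicalPotentialOfDensity (squareDispersion 1 0) (1 - δ)) ∧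
      FermiRG.HypA4 (FermiRG.Crystal.cubic 2)
        (fun q : Momentum => squareDispersion 1 0 q - chemicalPotentialOfDensity (squareDispersion 1 0) (1 - δ)) ∧
      FermiRG.HypSy (fun p : Momentum => squareDispersion 1 0 p - chemicalPotentialOfDensity (squareDispersion 1 0) (1 - δ))) ∧
    ¬ FermiRG.HypA5 (FermiRG.Crystal.cubic 2)
        (fun q : Momentum => squareDispersion 1 0 q - chemicalPotentialOfDensity (squareDispersion 1 0) (1 - δ)) ∧
    (∃ kk : Fin 4 → Fin 2 → ℝ, (∀ j i, |kk j i| < π) ∧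
      (∀ j, sqDispersion (kk j) = chemicalPotentialOfDensity (squareDispersion 1 0) (1 - δ)) ∧
      (![(1 : ℤ), 0] : Fin 2 → ℤ) ≠ 0 ∧ ∀ i, ∑ j, kk j i = 2 * π * ((![(1 : ℤ), 0] : Fin 2 → ℤ) i : ℝ)) ∧
    (∃ p q : Momentum, p ∈ fermiCurve (squareDispersion 1 0) (chemicalPotentialOfDensity (squareDispersion 1 0) (1 - δ)) ∧
      q ∈ fermiCurve (squareDispersion 1 0) (chemicalPotentialOfDensity (squareDispersion 1 0) (1 - δ)) ∧
      p + q ∉ brillouinZone) ∧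
    (∃ θ ∈ Ioo (0 : ℝ) (π / 4),
      rayDispersion (θ, 3 * bandFermiRadius (chemicalPotentialOfDensity (squareDispersion 1 0) (1 - δ)) θ) =
        chemicalPotentialOfDensity (squareDispersion 1 0) (1 - δ) ∧
      π < ‖(3 * bandFermiRadius (chemicalPotentialOfDensity (squareDispersion 1 0) (1 - δ)) θ) • dir θ‖) := by
  have hμ := (klfs_muOfDoping_mem_xwin hδ).1
  exact ⟨klfs_xwin_fst2_hypotheses hμ U k, klfs_xwin_umklapp hμ⟩

/-- **Corner transversality at `μ(δ)`, `δ ∈ [0.05, 0.25]`**: at the `(1,0)`-corner, `sin²x₁ - sin²y₁ ≥ 0.0428` (true minimum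
`0.043294` at `δ = 0.05`). [folklore] -/
theorem klfs_xdoping_corner_transversality_factor_ge {δ : ℝ} (hδ : δ ∈ Icc (0.05 : ℝ) 0.25) {θ : ℝ}
    (hθ : θ ∈ Ioo (0 : ℝ) (π / 4))
    (hcorner : rayDispersion (θ, 3 * bandFermiRadius (chemicalPotentialOfDensity (squareDispersion 1 0) (1 - δ)) θ) =
      chemicalPotentialOfDensity (squareDispersion 1 0) (1 - δ)) :
    (0.0428 : ℝ) ≤ Real.sin (bandX (chemicalPotentialOfDensity (squareDispersion 1 0) (1 - δ)) θ) ^ 2 -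
      Real.sin (bandY (chemicalPotentialOfDensity (squareDispersion 1 0) (1 - δ)) θ) ^ 2 :=
  klfs_xwin_corner_transversality_factor_ge (klfs_muOfDoping_mem_xwin hδ).1 hθ hcorner

/-- **The typed hypothesis sets at `μ(δ)`, `δ ∈ [0.05, 0.25]`**: FST II `GeomConstants e 4.5725 0.0375 0.381 0.0187`; FST III:
ONE datum `Admits M ⟨0, 42, normV, 0.38, 0.0375, 0.0187⟩` for any record carrying the band at `μ(δ)` with `v̂ ≡ U`,
`|U| ≤ normV`, the hypotheses (H1)–(H4) of Thm 1.2, and `¬(H5)` on the crystal's cell. [folklore] -/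
theorem klfs_xdoping_fst_constants {δ : ℝ} (hδ : δ ∈ Icc (0.05 : ℝ) 0.25) :
    FermiRG.GeomConstants
        (fun q : Momentum => squareDispersion 1 0 q - chemicalPotentialOfDensity (squareDispersion 1 0) (1 - δ))
        4.5725 0.0375 0.381 0.0187 ∧
    ∀ (M : FermiRG.FST3.Model 2),
      (M.e = fun p : Momentum => squareDispersion 1 0 p - chemicalPotentialOfDensity (squareDispersion 1 0) (1 - δ)) →
      ∀ {U : ℝ}, (M.vhat = fun _ => (U : ℂ)) → ∀ {normV : ℝ}, |U| ≤ normV →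
        FermiRG.FST3.Admits M ⟨0, 42, normV, 0.38, 0.0375, 0.0187⟩ ∧
        (FermiRG.FST3.H1 2 0 M ∧ FermiRG.FST3.H2 2 0 M ∧ FermiRG.FST3.H3 M ∧ FermiRG.FST3.H4 M) ∧
        (M.fund = (FermiRG.Crystal.cubic 2).fundamentalDomain → ¬ FermiRG.FST3.H5 M) := by
  have hμ := (klfs_muOfDoping_mem_xwin hδ).1
  exact ⟨klfs_xwin_geomConstants hμ, fun M he U hv normV hV => klfs_xwin_fst3 hμ M he hv hV⟩

/-- **The classes at `μ(δ)`, `δ ∈ [0.05, 0.25]`**: FST IV's inversion class EXCLUDES the band for every fundamental cell and all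
constants; BGM 2006's regime and `e₀`-admissibility fail and Lemma 2.1 clause (3) is false at `h = 0`; FKT 2004's hypotheses
fail; Salmhofer 1998 §2.3 `ModelData.Hyp` HOLDS. [folklore] -/
theorem klfs_xdoping_classes {δ : ℝ} (hδ : δ ∈ Icc (0.05 : ℝ) 0.25) :
    (∀ (L : FermiRG.FST4.LatticeData 2), L.latt = ((FermiRG.Crystal.cubic 2).dualLattice : Set Momentum) →
      (∀ z ∈ L.fund, ∀ w ∈ L.fund, z - w ∈ L.latt → z = w) → ∀ δ₀ g₀ G₀ w₀ : ℝ,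
      ¬ FermiRG.FST4.InDispersionClass L δ₀ g₀ G₀ w₀
        (fun p : Momentum => squareDispersion 1 0 p - chemicalPotentialOfDensity (squareDispersion 1 0) (1 - δ))) ∧
    (¬ (chemicalPotentialOfDensity (squareDispersion 1 0) (1 - δ) < -2 - Real.sqrt 2) ∧
      ∀ e₀ : ℝ, ¬ FermiRG.BGMAdmissibleE0 (chemicalPotentialOfDensity (squareDispersion 1 0) (1 - δ)) e₀) ∧
    (∀ {E : ℤ → ℝ × (Fin 2 → ℝ) → ℂ}, FermiRG.BGMInitial E → ∀ β : ℝ,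
      ∃ k : Fin (2 * 2) → Fin 2 → ℝ, (∀ j, k j ∈ FermiRG.zoneSq ∧
        FermiRG.bgmEffDisp β E 0 (k j) = chemicalPotentialOfDensity (squareDispersion 1 0) (1 - δ) + 0) ∧
        ¬ Real.sqrt ((∑ j, k j 0) ^ 2 + (∑ j, k j 1) ^ 2) < 2 * π) ∧
    (∀ (D : FermiRG.FKT2004.FermiCurveData),
      (D.e = fun k : Momentum => squareDispersion 1 0 k - chemicalPotentialOfDensity (squareDispersion 1 0) (1 - δ)) →
      ∀ r : ℕ, ¬ FermiRG.FKT2004.Hypotheses r D) ∧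
    (∀ (U : ℝ) {k₀ : ℕ}, 2 ≤ k₀ → ∀ {ε₀ : ℝ}, 0 < ε₀ → ε₀ ≤ 1 →
      (FermiRG.Salmhofer1998.ModelData.mk 1
        (fun p : Fin 2 → ℝ => sqDispersion p - chemicalPotentialOfDensity (squareDispersion 1 0) (1 - δ))
        (fun _ _ => U) (fun _ => U) k₀ ε₀ : FermiRG.Salmhofer1998.ModelData 2).Hyp) :=
  klfs_xwin_classes (klfs_muOfDoping_mem_xwin hδ).1

/-- **BGM 2003 at `μ(δ)`, `δ ∈ [0.05, 0.25]`, shell width `e₀ = 0.05`**: §1.2 `DispersionHyp`, the lattice class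
`LatticeModelHyp` (finitely supported pair potentials), and Lemma 3.1 (4.3) sector counting for the Hubbard band. [folklore] -/
theorem klfs_xdoping_bgm2003 {δ : ℝ} (hδ : δ ∈ Icc (0.05 : ℝ) 0.25) :
    FermiRG.BGM2003.DispersionHyp sqDispersion (chemicalPotentialOfDensity (squareDispersion 1 0) (1 - δ)) 0.05
        (fun θ e => bandFermiRadius (chemicalPotentialOfDensity (squareDispersion 1 0) (1 - δ) + e) θ) ∧
    (∀ (v : Fin 2 → Fin 2 → Literature.Probability.LatticeModels.Site 2 → ℝ),
      (∀ σ σ' : Fin 2, (Function.support (v σ σ')).Finite) →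
      FermiRG.BGM2003.LatticeModelHyp (fun k => sqDispersion k + 4)
        (chemicalPotentialOfDensity (squareDispersion 1 0) (1 - δ) + 4) 0.05
        (fun θ e => bandFermiRadius (chemicalPotentialOfDensity (squareDispersion 1 0) (1 - δ) + e) θ) v) ∧
    (∃ c : ℝ, 0 < c ∧ ∀ (n n' : ℕ), n ≤ n' →
      (∀ (L : ℕ) (i₁ : Fin L) (ω₁ : ℕ) (ωt : Fin L → ℕ), 4 ≤ L → ω₁ < sectorCount n' →
          (∀ i, ωt i < sectorCount n) →
          (Nat.card (FermiRG.BGM2003.sectorStrings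
              (fun ϑ e' => bandFermiRadius (chemicalPotentialOfDensity (squareDispersion 1 0) (1 - δ) + e') ϑ)
              0.05 n n' L i₁ ω₁ ωt) : ℝ) ≤ c ^ L * (2 : ℝ) ^ ((n' - n) * (L - 3))) ∧
      (∀ (i₁ : Fin 2) (ω₁ : ℕ) (ωt : Fin 2 → ℕ), ω₁ < sectorCount n' → (∀ i, ωt i < sectorCount n) →
          (Nat.card (FermiRG.BGM2003.sectorStrings
              (fun ϑ e' => bandFermiRadius (chemicalPotentialOfDensity (squareDispersion 1 0) (1 - δ) + e') ϑ)
              0.05 n n' 2 i₁ ω₁ ωt) : ℝ) ≤ c)) :=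
  klfs_xwin_bgm2003 (klfs_muOfDoping_mem_xwin hδ).1

/-- **Radial transversality at `μ(δ)`, `δ ∈ [0.05, 0.25]`**: `∂ₜF(θ, u(θ)) ≥ 0.5424` at every angle. [folklore] -/
theorem klfs_xdoping_rayDispersionDt_ge {δ : ℝ} (hδ : δ ∈ Icc (0.05 : ℝ) 0.25) (θ : ℝ) :
    (0.5424 : ℝ) ≤ rayDispersionDt θ (bandFermiRadius (chemicalPotentialOfDensity (squareDispersion 1 0) (1 - δ)) θ) :=
  klfs_xwin_rayDispersionDt_ge (klfs_muOfDoping_mem_xwin hδ).1 θ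

/-- **ONE two-loop constant for the extended doping window** (FST II Thm 1.1, `d = 2`): `∃ Q ≥ 1` with
`𝓦(ε') ≤ Q ε' |log ε'|` at `μ(δ)` for every `δ ∈ [0.05, 0.25]` and `0 < ε' ≤ 1/2`. [folklore] -/
theorem klfs_xdoping_volW_le :
    ∃ Q : ℝ, 1 ≤ Q ∧ ∀ δ ∈ Icc (0.05 : ℝ) 0.25, ∀ ε' : ℝ, 0 < ε' → ε' ≤ 1 / 2 →
      FermiRG.volW (FermiRG.Crystal.cubic 2)
        (fun q : Momentum => squareDispersion 1 0 q - chemicalPotentialOfDensity (squareDispersion 1 0) (1 - δ)) ε' ≤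
        ENNReal.ofReal (Q * ε' * |Real.log ε'|) := by
  obtain ⟨Q, hQ, h⟩ := klfs_xwin_volW_le
  exact ⟨Q, hQ, fun δ hδ ε' hε hε2 => h _ (klfs_muOfDoping_mem_xwin hδ).1 ε' hε hε2⟩

/-- **The SHARP `BandBounds` bundle covers every `μ(δ)`, `δ ∈ [0.05, 0.25]`**: ONE `BandBounds (-0.5725) (-0.075)` with
`umin ≥ 2.018`, `smax ≤ 4.06`, `A2 ≤ 51.1`, `hmin ≥ 0.0778`, `amin ≥ 0.0267`, `rhomin ≥ 0.2712`, `cmax ≤ 0.694`, `Dtmin ≥ 0.5424`,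
`C_g ≤ 556`, `Dcell ≤ 3.88`, whose level range contains `μ(δ)` for every `δ` of the extended doping window. [folklore] -/
theorem klfs_xdoping_sharpBandBounds :
    ∃ B : BandBounds (-0.5725) (-0.075),
      (2.018 ≤ B.umin ∧ B.smax ≤ 4.06 ∧ B.A2 ≤ 51.1 ∧ 0.0778 ≤ B.hmin ∧ 0.0267 ≤ B.amin ∧ 0.2712 ≤ B.rhomin ∧
        B.cmax ≤ 0.694 ∧ 0.5424 ≤ B.Dtmin ∧ B.Cg ≤ 556 ∧ B.Dcell ≤ 3.88) ∧
      ∀ δ ∈ Icc (0.05 : ℝ) 0.25, chemicalPotentialOfDensity (squareDispersion 1 0) (1 - δ) ∈ Icc (-0.5725 : ℝ) (-0.075) := by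
  obtain ⟨B, hB⟩ := klfs_xwin_sharpBandBounds
  exact ⟨B, hB, fun δ hδ => (klfs_muOfDoping_mem_xwin hδ).1⟩

/-! ### §2 The headline in one statement -/

/-- **Risk-register item r2 on the extended doping window, headline form**: for every `δ ∈ [0.05, 0.25]` the free band at
`μ(δ)` has a non-degenerate (`‖∇ε₀‖ ≥ 0.5425`), strictly convex (`κ ≥ 0.0132`) Fermi curve with no `(π,π)` nesting (defect
`≥ 0.15`), FST II's (A5) FAILS (umklapp present) and the `(1,0)`-corner exists — the conjunction the typed FST/BGM statements and
DECOMP's C4b consume, in the variable `δ`. [folklore] -/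
theorem klfs_xdoping_headline {δ : ℝ} (hδ : δ ∈ Icc (0.05 : ℝ) 0.25) :
    (∀ k ∈ fermiCurve (squareDispersion 1 0) (chemicalPotentialOfDensity (squareDispersion 1 0) (1 - δ)),
      (0.5425 : ℝ) ≤ ‖gradient (squareDispersion 1 0) k‖) ∧
    (∀ x y : ℝ, -2 * (Real.cos x + Real.cos y) = chemicalPotentialOfDensity (squareDispersion 1 0) (1 - δ) →
      (0.0132 : ℝ) ≤ (Real.cos x * Real.sin y ^ 2 + Real.cos y * Real.sin x ^ 2) /
        ((Real.sin x ^ 2 + Real.sin y ^ 2) * Real.sqrt (Real.sin x ^ 2 + Real.sin y ^ 2))) ∧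
    (∀ k : Fin 2 → ℝ, sqDispersion k = chemicalPotentialOfDensity (squareDispersion 1 0) (1 - δ) →
      (0.15 : ℝ) ≤ |sqDispersion (fun i => k i + π) - chemicalPotentialOfDensity (squareDispersion 1 0) (1 - δ)|) ∧
    ¬ FermiRG.HypA5 (FermiRG.Crystal.cubic 2)
        (fun q : Momentum => squareDispersion 1 0 q - chemicalPotentialOfDensity (squareDispersion 1 0) (1 - δ)) ∧
    (∃ θ ∈ Ioo (0 : ℝ) (π / 4),
      rayDispersion (θ, 3 * bandFermiRadius (chemicalPotentialOfDensity (squareDispersion 1 0) (1 - δ)) θ) =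
        chemicalPotentialOfDensity (squareDispersion 1 0) (1 - δ) ∧
      π < ‖(3 * bandFermiRadius (chemicalPotentialOfDensity (squareDispersion 1 0) (1 - δ)) θ) • dir θ‖) := by
  obtain ⟨hg, hκ, hn⟩ := klfs_xdoping_geometry hδ
  obtain ⟨-, hA5, -, -, hc⟩ := klfs_xdoping_fst2_umklapp hδ 0 0
  exact ⟨fun k hk => (hg k hk).2, fun x y h => (hκ x y h).1, hn, hA5, hc⟩

end Summit.HubbardSuperconductivity.HubbardSuperconductivity.Theorems

end
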